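import Summits.Ventures.HodgeRepro2.T5SU11IwasawaUnique

/-!
# The cocycle of the fibration `SU(1,1) → 𝔻` in closed form: `g · s(z) = s(g·z) · rot κ(g, z)`, `κ(g, z) = j(g, z)‾ / |j(g, z)|`

`T5SU11Fibration.exists_cocycle` gives, for `g ∈ SU(1,1)` and `z ∈ 𝔻`, SOME `u₀ ∈ Circle` with
`g · s(z) = s(g·z) · rot u₀`. This file identifies it: the `(0,0)` entries of the two matrices are
`r(g·z) u₀` and `r(z) (a + b z̄)` for `g = su11 a b` (`mat_mul_sec_zero_zero`,
`mat_sec_mul_rot_zero_zero`), so `u₀` is the PHASE of `a + b z̄ = conj (b̄ z + ā) = conj j(g, z)`, with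
`j(g, z) = denom (mat g) z` the automorphy factor: `cocycle g z := phase (conj j(g, z))` and
`g · s(z) = s(g·z) · rot (cocycle g z)` (`mul_sec_eq_sec_mul_rot`). Consequences: `r(g·z) = r(z) |j(g, z)|`
(`rad_mobius`), the cocycle identity `κ(gh, z) = κ(g, h·z) κ(h, z)` (`cocycle_mul`, from the cocycle
identity of `j` and the multiplicativity of the phase), `κ(1, z) = 1`, `κ(g⁻¹, g·z) κ(g, z) = 1`,
`κ(rot u, z) = u` (`cocycle_rot`), `κ(a_t, x) = 1` on the real diameter (`cocycle_hyp_real`),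
`κ(g, 0) = phase a` (`cocycle_zero`) hence the POLAR DECOMPOSITION `g = s(g·0) · rot (phase a)`
(`eq_sec_orbit_mul_rot`): the fibration map `Φ(z, u) = s(z) rot u` is a BIJECTION `𝔻 × K → SU(1,1)`
(`fib_injOn`, `fib_surjective`, `fib_bijOn`) and the left action reads `g · Φ(z, u) = Φ(g·z, κ(g, z) u)`
in these coordinates (`mul_fib`). Nothing is claimed about (N).

Blind lane: Mathlib + the HodgeRepro2 prefix only; no sorry; axioms ⊆ {propext, Classical.choice,
Quot.sound}.
-/

namespace Summit.Ventures.HodgeRepro2.T5SU11FibrationCocycle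

open Metric Complex
open T5PoincareDensity T5PoincareInvariance T5SU11Unimodular T5SU11Fibration T5BergmanCoefficient
  T5SU11Cartan T5SU11OneParameter T5SU11UnipotentSubgroup T5SU11IwasawaUnique

/-! ### The phase `z ↦ z / |z|` -/

/-- `phase z = z / ‖z‖` for `z ≠ 0`. -/
lemma coe_phase {z : ℂ} (hz : z ≠ 0) : (phase z : ℂ) = z / ‖z‖ := by
  have hn : ((‖z‖ : ℝ) : ℂ) ≠ 0 := by exact_mod_cast norm_ne_zero_iff.mpr hz
  rw [eq_div_iff hn, phase_mul_norm]

/-- The phase of a unit complex number is itself. -/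
lemma phase_coe (u : Circle) : phase (u : ℂ) = u := by
  apply Circle.ext
  have h := phase_mul_norm (u : ℂ)
  rwa [Circle.norm_coe, Complex.ofReal_one, mul_one] at h

/-- `phase 1 = 1`. -/
lemma phase_one : phase (1 : ℂ) = 1 := by
  have h := phase_coe 1
  rwa [Circle.coe_one] at h

/-- The phase is multiplicative on non-zero numbers. -/
lemma phase_mul {z w : ℂ} (hz : z ≠ 0) (hw : w ≠ 0) : phase (z * w) = phase z * phase w := by
  apply Circle.ext
  rw [Circle.coe_mul, coe_phase (mul_ne_zero hz hw), coe_phase hz, coe_phase hw, norm_mul,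
    div_mul_div_comm]
  push_cast
  rfl

/-- A positive real multiple has the same phase. -/
lemma phase_real_mul {c : ℝ} (hc : 0 < c) (z : ℂ) : phase ((c : ℂ) * z) = phase z := by
  rcases eq_or_ne z 0 with rfl | hz
  · rw [mul_zero]
  · have hc' : (c : ℂ) ≠ 0 := by exact_mod_cast hc.ne'
    apply Circle.ext
    rw [coe_phase (mul_ne_zero hc' hz), coe_phase hz, norm_mul, Complex.norm_real,
      Real.norm_eq_abs, abs_of_pos hc]
    push_cast
    rw [mul_div_mul_left _ _ hc']

/-- The phase of a positive real number is `1`. -/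
lemma phase_ofReal_of_pos {c : ℝ} (hc : 0 < c) : phase (c : ℂ) = 1 := by
  have h := phase_real_mul hc 1
  rwa [mul_one, phase_one] at h

/-! ### The automorphy factor `j(g, z) = denom (mat g) z = b̄ z + ā` -/

/-- `j(g, z) = b̄ z + ā` for `g = su11 a b`. -/
lemma denom_mat (g : SU11) (z : ℂ) :
    denom (mat g) z = (starRingEnd ℂ) (mat g 0 1) * z + (starRingEnd ℂ) (mat g 0 0) := by
  conv_lhs => rw [show mat g = su11 (mat g 0 0) (mat g 0 1) from coe_eq_su11 g]
  exact denom_su11 _ _ _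

/-- `j(g, z) ≠ 0` on the disc. -/
lemma denom_mat_ne_zero (g : SU11) {z : ℂ} (hz : z ∈ ball (0 : ℂ) 1) : denom (mat g) z ≠ 0 := by
  rw [denom_mat]
  exact denom_ne_zero (normSq_sub_normSq g) ((mem_ball_iff_normSq z).mp hz)

/-- `conj j(g, z) = a + b z̄`. -/
lemma conj_denom_mat (g : SU11) (z : ℂ) :
    (starRingEnd ℂ) (denom (mat g) z) = mat g 0 0 + mat g 0 1 * (starRingEnd ℂ) z := by
  rw [denom_mat, map_add, map_mul, Complex.conj_conj, Complex.conj_conj, add_comm]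

/-- The cocycle identity of `j` on `SU(1,1)`: `j(gh, z) = j(g, h·z) j(h, z)` for `z ∈ 𝔻`. -/
lemma denom_mat_mul (g h : SU11) {z : ℂ} (hz : z ∈ ball (0 : ℂ) 1) :
    denom (mat (g * h)) z = denom (mat g) (mobius (mat h) z) * denom (mat h) z := by
  rw [mat_mul]
  exact denom_mul _ _ _ (denom_mat_ne_zero h hz)

/-! ### The cocycle in closed form -/

/-- **The cocycle `κ(g, z)`**: the phase of `conj j(g, z) = a + b z̄` for `g = su11 a b`. -/
noncomputable def cocycle (g : SU11) (z : ℂ) : Circle :=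
  phase ((starRingEnd ℂ) (denom (mat g) z))

/-- `κ(g, z) = phase (a + b z̄)`. -/
lemma cocycle_eq (g : SU11) (z : ℂ) :
    cocycle g z = phase (mat g 0 0 + mat g 0 1 * (starRingEnd ℂ) z) := by
  rw [cocycle, conj_denom_mat]

/-- The `(0,0)` entry of `mat (g · s(z))`: `r(z) (a + b z̄)`. -/
lemma mat_mul_sec_zero_zero (g : SU11) {z : ℂ} (hz : z ∈ ball (0 : ℂ) 1) :
    mat (g * sec z) 0 0 = (rad z : ℂ) * (mat g 0 0 + mat g 0 1 * (starRingEnd ℂ) z) := by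
  set a := mat g 0 0 with ha
  set b := mat g 0 1 with hb
  have hg : mat g = su11 a b := coe_eq_su11 g
  rw [mat_mul, hg, show mat (sec z) = su11 (rad z : ℂ) ((rad z : ℂ) * clamp z) from
    coe_toSU11 _ _ _, clamp_of_mem_ball hz, su11_mul]
  simp only [su11, Matrix.of_apply, Matrix.cons_val', Matrix.cons_val_zero, Matrix.empty_val',
    Matrix.cons_val_fin_one, map_mul, Complex.conj_ofReal]
  ring

/-- The `(0,0)` entry of `mat (s(w) · rot u)`: `r(w) u`. -/
lemma mat_sec_mul_rot_zero_zero (w : ℂ) (u : Circle) :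
    mat (sec w * rot u) 0 0 = (rad w : ℂ) * u := by
  rw [mat_mul, show mat (sec w) = su11 (rad w : ℂ) ((rad w : ℂ) * clamp w) from coe_toSU11 _ _ _,
    show mat (rot u) = su11 (u : ℂ) 0 from coe_rot u, su11_mul]
  simp only [su11, Matrix.of_apply, Matrix.cons_val', Matrix.cons_val_zero, Matrix.empty_val',
    Matrix.cons_val_fin_one, map_zero, mul_zero, add_zero]

/-- **The cocycle in closed form**: `g · s(z) = s(g·z) · rot κ(g, z)` for `z ∈ 𝔻`, with
`κ(g, z) = phase (conj j(g, z)) = (a + b z̄) / |a + b z̄|` for `g = su11 a b`. -/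
theorem mul_sec_eq_sec_mul_rot (g : SU11) {z : ℂ} (hz : z ∈ ball (0 : ℂ) 1) :
    g * sec z = sec (mobius (mat g) z) * rot (cocycle g z) := by
  obtain ⟨u₀, hu₀⟩ := exists_cocycle g hz
  have hu : u₀ = cocycle g z := by
    have h1 := mat_mul_sec_zero_zero g hz
    rw [hu₀, mat_sec_mul_rot_zero_zero] at h1
    set w := mat g 0 0 + mat g 0 1 * (starRingEnd ℂ) z with hw
    have hr := rad_pos z
    have hr' := rad_pos (mobius (mat g) z)
    have hr'c : ((rad (mobius (mat g) z) : ℝ) : ℂ) ≠ 0 := by exact_mod_cast hr'.ne'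
    have hu₀' : (u₀ : ℂ) = ((rad z / rad (mobius (mat g) z) : ℝ) : ℂ) * w := by
      push_cast
      rw [div_mul_eq_mul_div, eq_div_iff hr'c, ← h1]
      ring
    rw [cocycle_eq, ← phase_real_mul (div_pos hr hr') w, ← hu₀', phase_coe]
  rw [hu₀, hu]

/-- **`r(g·z) = r(z) |j(g, z)|`**: the section scale transforms by the modulus of the automorphy
factor (the matrix form of `1 - |g·z|² = (1 - |z|²) / |j(g, z)|²`). -/
theorem rad_mobius (g : SU11) {z : ℂ} (hz : z ∈ ball (0 : ℂ) 1) :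
    rad (mobius (mat g) z) = rad z * ‖denom (mat g) z‖ := by
  have h1 := mat_mul_sec_zero_zero g hz
  rw [mul_sec_eq_sec_mul_rot g hz, mat_sec_mul_rot_zero_zero] at h1
  have h2 := congrArg norm h1
  rw [norm_mul, norm_mul, Circle.norm_coe, mul_one, Complex.norm_real, Complex.norm_real,
    Real.norm_eq_abs, Real.norm_eq_abs, abs_of_pos (rad_pos _), abs_of_pos (rad_pos _)] at h2
  rw [h2, ← Complex.norm_conj (denom (mat g) z), conj_denom_mat]

/-! ### The cocycle identity and the special subgroups -/

/-- **The cocycle identity**: `κ(gh, z) = κ(g, h·z) · κ(h, z)` on the disc. -/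
theorem cocycle_mul (g h : SU11) {z : ℂ} (hz : z ∈ ball (0 : ℂ) 1) :
    cocycle (g * h) z = cocycle g (mobius (mat h) z) * cocycle h z := by
  unfold cocycle
  rw [denom_mat_mul g h hz, map_mul]
  exact phase_mul ((map_ne_zero _).mpr (denom_mat_ne_zero g (mobius_mem_ball h hz)))
    ((map_ne_zero _).mpr (denom_mat_ne_zero h hz))

/-- `mat 1 = 1`. -/
lemma mat_one : mat (1 : SU11) = 1 := by
  show (((1 : SU11) : Matrix.SpecialLinearGroup (Fin 2) ℂ) : Matrix (Fin 2) (Fin 2) ℂ) = 1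
  rw [OneMemClass.coe_one, Matrix.SpecialLinearGroup.coe_one]

/-- `κ(1, z) = 1`. -/
theorem cocycle_one (z : ℂ) : cocycle 1 z = 1 := by
  rw [cocycle_eq, mat_one, Matrix.one_apply_eq, Matrix.one_apply_ne (by decide), zero_mul, add_zero,
    phase_one]

/-- `κ(g⁻¹, g·z) · κ(g, z) = 1`. -/
theorem cocycle_inv_mul (g : SU11) {z : ℂ} (hz : z ∈ ball (0 : ℂ) 1) :
    cocycle g⁻¹ (mobius (mat g) z) * cocycle g z = 1 := by
  rw [← cocycle_mul g⁻¹ g hz, inv_mul_cancel, cocycle_one]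

/-- `κ(rot u, z) = u`: the rotation subgroup acts with the tautological cocycle. -/
theorem cocycle_rot (u : Circle) (z : ℂ) : cocycle (rot u) z = u := by
  rw [cocycle_eq, mat_rot_zero_zero, show mat (rot u) 0 1 = 0 from by
    rw [show mat (rot u) = su11 (u : ℂ) 0 from coe_rot u]; rfl, zero_mul, add_zero, phase_coe]

/-- `κ(a_t, z) = phase (cosh t + sinh t · z̄)`. -/
theorem cocycle_hyp (t : ℝ) (z : ℂ) :
    cocycle (hyp t) z = phase ((Real.cosh t : ℂ) + (Real.sinh t : ℂ) * (starRingEnd ℂ) z) := by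
  rw [cocycle_eq, show mat (hyp t) 0 0 = (Real.cosh t : ℂ) from by rw [mat_hyp]; rfl,
    show mat (hyp t) 0 1 = (Real.sinh t : ℂ) from by rw [mat_hyp]; rfl]

/-- `κ(n_s, z) = phase ((1 + i s) - i s z̄)`. -/
theorem cocycle_unip (s : ℝ) (z : ℂ) :
    cocycle (unip s) z = phase ((1 + (s : ℂ) * I) + (-((s : ℂ) * I)) * (starRingEnd ℂ) z) := by
  rw [cocycle_eq, show mat (unip s) 0 0 = 1 + (s : ℂ) * I from by rw [mat_unip]; rfl,
    show mat (unip s) 0 1 = -((s : ℂ) * I) from by rw [mat_unip]; rfl]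

/-- **`κ(a_t, x) = 1` on the real diameter**: for real `x` with `|x| < 1`, `cosh t + sinh t · x > 0`. -/
theorem cocycle_hyp_real (t : ℝ) {x : ℝ} (hx : |x| < 1) : cocycle (hyp t) (x : ℂ) = 1 := by
  rw [cocycle_hyp, Complex.conj_ofReal, ← Complex.ofReal_mul, ← Complex.ofReal_add]
  have h1 : |Real.sinh t * x| < Real.cosh t := by
    rw [abs_mul]
    calc |Real.sinh t| * |x| ≤ |Real.sinh t| * 1 :=
          mul_le_mul_of_nonneg_left hx.le (abs_nonneg _)
      _ = Real.sinh |t| := by rw [mul_one, Real.abs_sinh]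
      _ < Real.cosh |t| := Real.sinh_lt_cosh _
      _ = Real.cosh t := Real.cosh_abs t
  have hpos : 0 < Real.cosh t + Real.sinh t * x := by linarith [neg_abs_le (Real.sinh t * x)]
  exact phase_ofReal_of_pos hpos

/-! ### The polar decomposition `g = s(g·0) · rot (phase a)` and the fibration coordinates -/

/-- `κ(g, 0) = phase a` for `g = su11 a b`. -/
theorem cocycle_zero (g : SU11) : cocycle g 0 = phase (mat g 0 0) := by
  rw [cocycle_eq, map_zero, mul_zero, add_zero]

/-- `r(0) = 1`. -/
lemma rad_zero : rad 0 = 1 := by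
  unfold rad
  rw [clamp_of_mem_ball (mem_ball_self one_pos), map_zero, sub_zero, Real.sqrt_one, inv_one]

/-- `s(0) = 1`. -/
lemma sec_zero : sec 0 = 1 := by
  apply ext_mat
  rw [show mat (sec 0) = su11 (rad 0 : ℂ) ((rad 0 : ℂ) * clamp 0) from coe_toSU11 _ _ _, rad_zero,
    clamp_of_mem_ball (mem_ball_self one_pos), mul_zero, mat_one, Complex.ofReal_one]
  ext i j
  fin_cases i <;> fin_cases j <;> simp [su11]

/-- **The polar decomposition**: `g = s(g·0) · rot (phase a)` with `a = g₀₀` — every element of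
`SU(1,1)` is the section at its orbit point times a rotation. -/
theorem eq_sec_orbit_mul_rot (g : SU11) : g = sec (orbit g) * rot (phase (mat g 0 0)) := by
  have h := mul_sec_eq_sec_mul_rot g (mem_ball_self one_pos)
  rw [sec_zero, mul_one, cocycle_zero] at h
  exact h

/-- **The fibration coordinates are injective on `𝔻 × K`**: `s(z) rot u = s(z') rot u'` with
`z, z' ∈ 𝔻` forces `z = z'` and `u = u'`. -/
theorem fib_injOn : Set.InjOn fib (ball (0 : ℂ) 1 ×ˢ Set.univ) := by
  rintro ⟨z, u⟩ ⟨hz, -⟩ ⟨z', u'⟩ ⟨hz', -⟩ h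
  have hzz : z = z' := by
    have := congrArg orbit h
    rwa [orbit_fib hz, orbit_fib hz'] at this
  subst hzz
  change sec z * rot u = sec z * rot u' at h
  rw [rot_injective (mul_left_cancel h)]

/-- **The fibration coordinates are onto**: `g = Φ(g·0, phase a)`. -/
theorem fib_surjective : Function.Surjective fib := fun g =>
  ⟨(orbit g, phase (mat g 0 0)), (eq_sec_orbit_mul_rot g).symm⟩

/-- **`Φ : 𝔻 × K → SU(1,1)` is a bijection.** -/
theorem fib_bijOn : Set.BijOn fib (ball (0 : ℂ) 1 ×ˢ Set.univ) Set.univ :=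
  ⟨Set.mapsTo_univ _ _, fib_injOn, fun g _ =>
    ⟨(orbit g, phase (mat g 0 0)), ⟨orbit_mem_ball g, Set.mem_univ _⟩,
      (eq_sec_orbit_mul_rot g).symm⟩⟩

/-- **The left action in fibration coordinates**: `g · Φ(z, u) = Φ(g·z, κ(g, z) u)` for `z ∈ 𝔻`. -/
theorem mul_fib (g : SU11) {z : ℂ} (hz : z ∈ ball (0 : ℂ) 1) (u : Circle) :
    g * fib (z, u) = fib (mobius (mat g) z, cocycle g z * u) := by
  change g * (sec z * rot u) = sec (mobius (mat g) z) * rot (cocycle g z * u)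
  rw [← mul_assoc, mul_sec_eq_sec_mul_rot g hz, mul_assoc, ← map_mul]

end Summit.Ventures.HodgeRepro2.T5SU11FibrationCocycle
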